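import Summits.QuantumFields.YangMills.Theorems.BalabanUVNodesN18TransportClausesReduction
import Summits.QuantumFields.YangMills.Theorems.UnitScaleTiltProp8ChartCovariance
import Summits.QuantumFields.BalabanUV.T4Continuum.Support.B13Carriers
import Literature.MathematicalPhysics.QuantumFieldTheory.Balaban1983to89.Node00.HistoryTransportOfRecord
import Literature.MathematicalPhysics.QuantumFieldTheory.Balaban1983to89.Node00.DatumAvLayer
import HarnessLib

/-!
# BalabanUVNodes ∕ node N18 = NE5 — closure-ledger item (iii): (T2) FOR THE PAIR TRANSPORT OF RECORD, AND THE KNIT OF THE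
# TRANSPORT-CLAUSE REDUCTION AT `TcfgOfRecord ∕ TΦOfRecord` (Track A, DAG node N18 = `T4OutputRate.NE5` :211; cluster K4 «SpineRates», item K3⁷
# `SpineGivenEndpointR13SepCoPH`; seat pub-ymgap-dag-n18-w3 g3, the (β) successor lane of pub-ymgap-dag-n18-d)

HONEST FRAMING.  Count-neutral kernel bookkeeping (`--supports stmt-QuantumFields-20544 --as helper`): exact covariance ALGEBRA of the pair transport of
record (no estimate) and the instantiation of module 21 v1.1 (`Thm/BalabanUVNodesN18TransportClausesReduction`, §4 orbit form) at node00-def-W1's W1-18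
objects (`Node00/HistoryTransportOfRecord`: `TΦOfRecord`, `TcfgOfRecord`, the (T1) laws `TcfgOfRecord_embedPair` ∕ `TcfgOfRecord_ofBackgroundC`).  The analysis
input (T3) — «(i)–(iii) of run B at level `j+1` on `π(j, Y)` ⟹ some `Gᶜ`-gauge transform of the transported pair satisfies (i)–(iii) of run A at level `j`
on `Y`» — stays a DISPLAYED hypothesis `hsat`; so do the positivity of run A's radii (`hα`) and the small-field guard of run B's admissible backgrounds (`hsm`,
def-W1's «hsm», or a plaquette box).  NE5 is NOT PRINTED and NOT proved; N18 is NOT discharged; nothing about the continuum ∕ OS ∕ mass gap ∕ Clay.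

WHY.  Module 21 reduces BOTH transport hypotheses of N18's germ reading at the table of record — `hT₀` of `RateRecordW1MapsAdm.LevelPairing.ofRecordAdm` and
`hTsp` of W1-14's germ faces — to a units-level pair transport `TΦ` with a configuration transport `Tcfg` satisfying (T1) compatibility + background face,
(T2) `Gᶜ`-covariance up to a run-A gauge, (T3) the transport of (i)–(iii) in orbit form.  W1-18 supplies the inhabitant `TΦOfRecord Φ = (fieldShift (Ū), 0)`
(`Ū = avgUnits Φ.U`, the (0.4) average continued to `GL(N, ℂ)`-valued fields) with both (T1) laws proved and lists as «remaining by name»: (T2) = the UST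
pen's exact covariance `Prop8Chart.emlAvgU_gaugeActT` ([Balaban1985Averaging] (11), `Ū(𝐔^u) = Ū(𝐔)^{u∘emb}`, ANY `u`, no smallness) + the level
identification's intertwining of gauge transformations (`fieldShift_gaugeAct`, here for `𝔸ˣ`) on the `𝐔`-half, and `R(u′)0 = 0` on the `𝐉`-half.  This file
proves (T2) and performs the instantiation, so that the (β) analysis lane's target is literally ONE displayed signature: `hsat` below.

WHAT.
* §1 `fieldShift_gaugeU`, `avgUnits_gaugeU`, `adJ_const_zero`, ★ `TΦOfRecord_act` (`TΦ (Φ^u) = (TΦ Φ)^{u ∘ emb ∘ siteShift}`, exact), ★ `hcov_TΦOfRecord` (module 21's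
  `hcov` between two settings with `Gcᴮ ≤ Gcᴬ`).
* §2 (credit: ym-lens-BalabanUVNodes-transfer g33, T50, re-proved) the `𝐉`-half of (1.14) at `TΦOfRecord` is definitional: `TΦOfRecord_J_mem_gc`,
  `TΦOfRecord_J_norm_lt`, `condIII_TΦOfRecord_of_plaq`, `condIII_TΦOfRecord_iff`.
* §3 `transportRaw_avOfRecord_eq_fieldShift` (the tree's `T₀` of record IS W1-18's background face map, `rfl`), ★★ `admTransport_spaceOfRecord_unit_ofRecord_orbit`
  (module 21 §4 at the objects of record: `hcompat`, `hface`, `hcov` DISCHARGED; displayed: `hGc`, `hsm`, `hα`, `hsat`), ★★ `…_of_plaqBound` (the guard from a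
  plaquette box on run B's admissible backgrounds, [Balaban1985Averaging] Prop. 1 via W1-18 `TcfgOfRecord_ofBackgroundC_of_plaqBound`).

0 `def`, 0 `sorry`.  References: T. Bałaban, CMP **109** (1987) 249–301 [Balaban1987RG1] ((0.4) p.253, (0.21)–(0.25) pp.256–257, (1.10)–(1.16) p.262);
CMP **98** (1985) 17–51 [Balaban1985Averaging] ((8)–(11) pp.18–19, Prop. 1 (51) p.26); CMP **116** (1988) 1–22 [Balaban1988RG2Cluster] ((2.13)–(2.14) pp.14–15).
-/

noncomputable section

open Set
open scoped Matrix.Norms.L2Operator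

namespace YMDAG.N18.TransportOfRecord

open Literature.MathematicalPhysics.QuantumFieldTheory.Balaban1983to89
open Literature.MathematicalPhysics.QuantumFieldTheory.Balaban1983to89.T4Continuum
open Literature.MathematicalPhysics.QuantumFieldTheory.Balaban1983to89.T4LevelShift
open Literature.MathematicalPhysics.QuantumFieldTheory.Balaban1983to89.B12RegularSpaces111
open Literature.MathematicalPhysics.QuantumFieldTheory.Balaban1983to89.Node00 (MatA ιSU)
open Literature.MathematicalPhysics.QuantumFieldTheory.Balaban1983to89.Node00.Sect2 (domSys domSites CPair ofBackgroundC embedPair spaceI frameI Setting Residual)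
open Literature.MathematicalPhysics.QuantumFieldTheory.Balaban1983to89.Node00.W1
open Literature.MathematicalPhysics.QuantumFieldTheory.Balaban1983to89.BlockAveraging (Small avgFun)
open Literature.MathematicalPhysics.QuantumFieldTheory.Balaban1983to89.ExpMeanLog (expMeanLogSU deltaSU)
open Summit.QuantumFields.BalabanUV.T4Continuum.B13Carriers (transportRaw)

/-! ## §1 (T2): exact covariance of the pair transport of record -/

section Algebra

variable {F : T4Family} {K j K' j' : ℕ} {R : Type*} [Ring R]

/-- The level identification intertwines the gauge action on units-valued configurations: `fieldShift h (𝐔^u) = (fieldShift h 𝐔)^{u ∘ siteShift h}`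
(the `𝔸ˣ` twin of `T4LevelShift.fieldShift_gaugeAct`; bond ends correspond by `bondShift_tgt`). [cite: Balaban1987RG1, (0.1) p.251 and (1.10) p.262] -/
theorem fieldShift_gaugeU (h : (F.P K).sitesPerDir j = (F.P K').sitesPerDir j') (u : Site (F.P K') j' → Rˣ) (V : GaugeField (F.P K') j' Rˣ) :
    fieldShift h (gaugeU u V) = gaugeU (fun x => u (siteShift h x)) (fieldShift h V) := by
  funext b
  show u (bondShift h b).src * V (bondShift h b) * (u (bondShift h b).tgt)⁻¹ = _
  rw [bondShift_tgt]
  rfl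

end Algebra

section Avg

variable {P : Params} {j : ℕ} {𝔸 : Type*} [NormedRing 𝔸] [NormedAlgebra ℂ 𝔸] [CompleteSpace 𝔸]

/-- **[Balaban1985Averaging] (11) COMPLEXIFIED**: the (0.4) average of record continued to `𝔸ˣ`-valued fields is EXACTLY covariant under every gauge
transformation `u` — `Ū(𝐔^u) = (Ū𝐔)^{u ∘ emb}` (no smallness, no unitarity: `exp[mean log]` commutes with conjugation).  This is the UnitScaleTilt pen's
`Prop8Chart.emlAvgU_gaugeActT` read through the Summit-side `rfl` `W1.avgUnits = Prop8Chart.emlAvgU` (W1-18 docstring). [cite: Balaban1985Averaging, (11) p.19] -/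
theorem avgUnits_gaugeU (u : Site P j → 𝔸ˣ) (U : GaugeField P j 𝔸ˣ) :
    avgUnits (gaugeU u U) = gaugeU (fun y : Site P (j + 1) => u (emb y)) (avgUnits U) :=
  Summit.QuantumFields.YangMills.Theorems.Prop8Chart.emlAvgU_gaugeActT u U

omit [NormedAlgebra ℂ 𝔸] [CompleteSpace 𝔸] in
/-- `R(u)0 = 0`: the adjoint action (1.10) on the `𝐉`-slot fixes the zero configuration. [cite: Balaban1987RG1, (1.10) p.262] -/
theorem adJ_const_zero {i : ℕ} (u : Site P i → 𝔸ˣ) : adJ u (fun _ : PBond P i => (0 : 𝔸)) = fun _ => 0 := by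
  funext b
  simp [adJ]

end Avg

section Record

variable {F : T4Family} {N k : ℕ}

/-- Pairs with equal components are equal. [folklore] -/
private theorem fieldPair_ext' {P : Params} {i : ℕ} {G A : Type*} {Φ Ψ : FieldPair P i G A} (hU : Φ.U = Ψ.U) (hJ : Φ.J = Ψ.J) : Φ = Ψ := by
  cases Φ; cases Ψ; cases hU; cases hJ; rfl

/-- ★ **(T2) FOR THE PAIR TRANSPORT OF RECORD, EXACT**: `TΦ(Φ^u) = (TΦ Φ)^{u′}` with the coarse transformation `u′ = u ∘ emb ∘ siteShift` (run B's
`u` read at the block centres, identified with run A's unit lattice) — for EVERY `GL(N, ℂ)`-valued `u`, with no smallness: the `𝐔`-half by (11) complexified and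
the level identification, the `𝐉`-half because the transport resets `𝐉` to `0` and `R(u′)0 = 0`. [cite: Balaban1985Averaging, (11) p.19; Balaban1987RG1, (1.10) and (1.15) p.262] -/
theorem TΦOfRecord_act (u : Site (F.P (k + 1)) 0 → (MatA N)ˣ) (Φ : FieldPair (F.P (k + 1)) 0 (MatA N)ˣ (MatA N)) :
    TΦOfRecord F N k (act u Φ) =
      act (fun x => u (emb (siteShift (sitesPerDir_ladder F (K := k) (j := 0) rfl rfl) x))) (TΦOfRecord F N k Φ) := by
  refine fieldPair_ext' ?_ ?_
  · funext b
    show avgUnits (gaugeU u Φ.U) (bondShift (sitesPerDir_ladder F (K := k) (j := 0) rfl rfl) b) =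
      u (emb (siteShift (sitesPerDir_ladder F (K := k) (j := 0) rfl rfl) b.src)) *
          avgUnits Φ.U (bondShift (sitesPerDir_ladder F (K := k) (j := 0) rfl rfl) b) *
        (u (emb (siteShift (sitesPerDir_ladder F (K := k) (j := 0) rfl rfl) b.tgt)))⁻¹
    rw [avgUnits_gaugeU, ← bondShift_tgt]
    rfl
  · funext b
    simp only [act, adJ, TΦOfRecord_J, mul_zero, zero_mul]

/-- ★ **MODULE 21's DISPLAYED `hcov` FOR `TΦ := TΦOfRecord F N k`** between a run-B setting and a run-A setting whose complex groups are nested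
(`Gcᴮ ≤ Gcᴬ`; `le_rfl` for a run-constant setting of record): a `Gcᴮ`-valued `u` is answered by the `Gcᴬ`-valued `u′ = u ∘ emb ∘ siteShift`.
[cite: Balaban1985Averaging, (11) p.19; Balaban1987RG1, (1.10) p.262] -/
theorem hcov_TΦOfRecord (SgB SgA : Setting (MatA N) (Node00.SU N)) (hGc : SgB.𝓜.Gc ≤ SgA.𝓜.Gc) :
    ∀ (u : Site (F.P (k + 1)) 0 → (MatA N)ˣ) (Φ : FieldPair (F.P (k + 1)) 0 (MatA N)ˣ (MatA N)), (∀ x, u x ∈ SgB.𝓜.Gc) →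
      ∃ u' : Site (F.P k) 0 → (MatA N)ˣ, (∀ x, u' x ∈ SgA.𝓜.Gc) ∧ TΦOfRecord F N k (act u Φ) = act u' (TΦOfRecord F N k Φ) :=
  fun u Φ hu => ⟨_, fun _ => hGc (hu _), TΦOfRecord_act u Φ⟩

/-! ## §2 The `𝐉`-half of (1.14) at the transport of record is definitional (credit: ym-lens-BalabanUVNodes-transfer g33, T50) -/

/-- The `𝐉`-slot of the transport of record is `𝔤ᶜ`-valued on the bonds of ANY region, for ANY model (`J := 0 ∈ 𝔤ᶜ`, a submodule).
(Lens T50 (a), re-proved.) [cite: Balaban1987RG1, (1.15) p.262] -/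
theorem TΦOfRecord_J_mem_gc (𝓜 : Model (MatA N)) (Ψ : FieldPair (F.P (k + 1)) 0 (MatA N)ˣ (MatA N)) (X : Region (F.P k) 0) :
    ∀ b ∈ X.bonds, (TΦOfRecord F N k Ψ).J b ∈ 𝓜.gc := fun b _ => by
  rw [TΦOfRecord_J]
  exact Submodule.zero_mem _

/-- The `𝐉`-clause `|𝐉| < γ₀` of (1.14) for the transported pair holds from `0 < γ₀` ALONE. (Lens T50 (b), re-proved.) [cite: Balaban1987RG1, (1.14) p.262] -/
theorem TΦOfRecord_J_norm_lt (Ψ : FieldPair (F.P (k + 1)) 0 (MatA N)ˣ (MatA N)) (X : Region (F.P k) 0) {γ₀ : ℝ} (hγ₀ : 0 < γ₀) :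
    ∀ b ∈ X.bonds, ‖(TΦOfRecord F N k Ψ).J b‖ < γ₀ := fun b _ => by
  rw [TΦOfRecord_J, norm_zero]
  exact hγ₀

/-- `CondIII` (1.14) of the transported pair FROM THE PLAQUETTE LETTER OF `Ū` ALONE (given `0 < γ₀`). (Lens T50 (c), re-proved.)
[cite: Balaban1987RG1, (1.14) p.262] -/
theorem condIII_TΦOfRecord_of_plaq (Ψ : FieldPair (F.P (k + 1)) 0 (MatA N)ˣ (MatA N)) (X : Region (F.P k) 0) (c : StepConsts) {α₀ γ₀ : ℝ}
    (hγ₀ : 0 < γ₀) (hplaq : ∀ p ∈ X.plaqs, ‖(↑(plaq (TΦOfRecord F N k Ψ).U p) : MatA N) - 1‖ < α₀ * c.ξ ^ 2) :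
    CondIII X c α₀ γ₀ (TΦOfRecord F N k Ψ).U (TΦOfRecord F N k Ψ).J :=
  ⟨hplaq, TΦOfRecord_J_norm_lt Ψ X hγ₀⟩

/-- Conversely `CondIII` of the transported pair IS the plaquette letter of `Ū` together with (`0 < γ₀` on every bond of `X`): the `𝐉`-clause carries no
transported content. (Lens T50 (d), re-proved.) [cite: Balaban1987RG1, (1.14) p.262] -/
theorem condIII_TΦOfRecord_iff (Ψ : FieldPair (F.P (k + 1)) 0 (MatA N)ˣ (MatA N)) (X : Region (F.P k) 0) (c : StepConsts) (α₀ γ₀ : ℝ) :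
    CondIII X c α₀ γ₀ (TΦOfRecord F N k Ψ).U (TΦOfRecord F N k Ψ).J ↔
      (∀ p ∈ X.plaqs, ‖(↑(plaq (TΦOfRecord F N k Ψ).U p) : MatA N) - 1‖ < α₀ * c.ξ ^ 2) ∧ ∀ b ∈ X.bonds, (0 : ℝ) < γ₀ := by
  constructor
  · rintro ⟨hp, hJ⟩
    exact ⟨hp, fun b hb => by simpa [TΦOfRecord_J] using hJ b hb⟩
  · rintro ⟨hp, hγ⟩
    exact ⟨hp, fun b hb => by rw [TΦOfRecord_J, norm_zero]; exact hγ b hb⟩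

/-! ## §3 The knit: module 21 v1.1 §4 at the objects of record -/

variable [NeZero N]

/-- The tree's background transport of record run `k+1 → k`, `transportRaw F k (avOfRecord F N (k+1) 0)` (one (0.4) averaging `blockAvg expMeanLogSU` on run
B's finest lattice, then the level identification), IS W1-18's background-face map `fieldShift (sitesPerDir_ladder F rfl rfl) ∘ avgFun expMeanLogSU` — by `rfl`.
[cite: Balaban1987RG1, (0.4) p.253; Balaban1988RG2Cluster, (2.13) p.14] -/
theorem transportRaw_avOfRecord_eq_fieldShift (U : GaugeField (F.P (k + 1)) 0 (Node00.SU N)) :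
    transportRaw F k (Node00.avOfRecord F N (k + 1) 0) U =
      fieldShift (sitesPerDir_ladder F (K := k) (j := 0) rfl rfl) (avgFun (expMeanLogSU (n := Fin N)) U) :=
  rfl

variable (F N) (M k : ℕ)

/-- ★★ **BOTH TRANSPORT CLAUSES OF N18's READING AT THE TABLE OF RECORD, FROM (T3) IN ORBIT FORM ALONE, AT THE TRANSPORTS OF RECORD** — module 21 v1.1 §4
`admTransport_spaceOfRecord_unit_of_unitsTransport_orbit` with `Tcfg := W1.TcfgOfRecord F N k`, `TΦ := W1.TΦOfRecord F N k`, `T₀ := transportRaw F k (avOfRecord F N (k+1) 0)`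
and its three structural hypotheses DISCHARGED: `hcompat` by W1-18 `TcfgOfRecord_embedPair`, `hface` by W1-18 `TcfgOfRecord_ofBackgroundC` under the guard `hsm`,
`hcov` by §1 `hcov_TΦOfRecord`.  Displayed: `hGc` (run B's `Gᶜ` inside run A's — `le_rfl` at a run-constant setting), `hsm` (run B's admissible backgrounds have
`δ_N`-small (0.4) loop variables at every coarse bond — def-W1's «hsm»; `…_of_plaqBound` below feeds it from a plaquette box), `hα` (run A's radii positive),
`hsat` ((T3) in orbit form at the unit recipe — THE analysis input).  Conclusion: the table clause `hTsp` of W1-14's germ faces ∕ module 20 AND the background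
clause `hT₀` of `LevelPairing.ofRecordAdm` at run length `k`. [cite: Balaban1987RG1, (0.21)-(0.25) pp.256-257, (1.10)-(1.16) p.262; Balaban1985Averaging, (11) p.19] -/
theorem admTransport_spaceOfRecord_unit_ofRecord_orbit (Sg : ℕ → Setting (MatA N) (Node00.SU N)) (α₀ α₁ : ℕ → ℕ → ℝ)
    (hGc : (Sg (k + 1)).𝓜.Gc ≤ (Sg k).𝓜.Gc)
    (hsm : ∀ U : GaugeField (F.P (k + 1)) 0 (Node00.SU N),
      (∀ (j : ℕ) (Y : (domSys (F.P (k + 1)) M j).Dom),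
        ofBackgroundC (ιSU N) U ∈ spaceOfRecord (M := M) (Sg (k + 1)) (Residual.unit (F.P (k + 1)) (MatA N)) (α₀ (k + 1)) (α₁ (k + 1)) j Y) →
        ∀ c, Small (expMeanLogSU (n := Fin N)) U c)
    (hα : ∀ j, 0 < α₀ k j)
    (hsat : ∀ (j : ℕ) (Y : (domSys (F.P k) M j).Dom) (Φ : FieldPair (F.P (k + 1)) 0 (MatA N)ˣ (MatA N)),
      SatisfiesI_III (Sg (k + 1)).𝓜 (frameI (Residual.unit (F.P (k + 1)) (MatA N)) M (j + 1) (domSites (F.P (k + 1)) M (j + 1) (pairOfRecord F M k ⟨j, Y⟩).2))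
          (StepConsts.ofParams (F.P (k + 1)) (Sg (k + 1)).cB (j + 1)) (α₀ (k + 1) (j + 1)) (α₁ (k + 1) (j + 1)) (α₀ (k + 1) (j + 1)) Φ →
        ∃ w : Site (F.P k) 0 → (MatA N)ˣ, (∀ x, w x ∈ (Sg k).𝓜.Gc) ∧
          SatisfiesI_III (Sg k).𝓜 (frameI (Residual.unit (F.P k) (MatA N)) M j (domSites (F.P k) M j Y)) (StepConsts.ofParams (F.P k) (Sg k).cB j) (α₀ k j)
            (α₁ k j) (α₀ k j) (act w (TΦOfRecord F N k Φ))) :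
    (∀ (X : Node00.W1.Dom (F.P k) M) (ψ : CPair (F.P (k + 1)) (MatA N)),
        ψ ∈ spaceOfRecord (M := M) (Sg (k + 1)) (Residual.unit (F.P (k + 1)) (MatA N)) (α₀ (k + 1)) (α₁ (k + 1)) (pairOfRecord F M k X).1
            (pairOfRecord F M k X).2 →
          TcfgOfRecord F N k ψ ∈ spaceOfRecord (M := M) (Sg k) (Residual.unit (F.P k) (MatA N)) (α₀ k) (α₁ k) X.1 X.2) ∧
      ∀ U : GaugeField (F.P (k + 1)) 0 (Node00.SU N),
        (∀ (j : ℕ) (Y : (domSys (F.P (k + 1)) M j).Dom),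
            ofBackgroundC (ιSU N) U ∈ spaceOfRecord (M := M) (Sg (k + 1)) (Residual.unit (F.P (k + 1)) (MatA N)) (α₀ (k + 1)) (α₁ (k + 1)) j Y) →
          ∀ (j : ℕ) (Y : (domSys (F.P k) M j).Dom),
            ofBackgroundC (ιSU N) (transportRaw F k (Node00.avOfRecord F N (k + 1) 0) U) ∈
              spaceOfRecord (M := M) (Sg k) (Residual.unit (F.P k) (MatA N)) (α₀ k) (α₁ k) j Y :=
  YMDAG.N18.TransportReduction.admTransport_spaceOfRecord_unit_of_unitsTransport_orbit F N M k (TcfgOfRecord F N k) (TΦOfRecord F N k) Sg α₀ α₁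
    (transportRaw F k (Node00.avOfRecord F N (k + 1) 0)) (fun U hU => TcfgOfRecord_ofBackgroundC U (hsm U hU)) TcfgOfRecord_embedPair
    (hcov_TΦOfRecord (Sg (k + 1)) (Sg k) hGc) hα hsat

/-- ★★ **THE SAME WITH THE GUARD FED FROM A PLAQUETTE BOX** on run B's admissible backgrounds: if every admissible `U` has all its plaquette variables within
`a` of `1` with `((d+2)L)²·a∕4 < δ_N` (`= 9L²a` at `d = 4`), [Balaban1985Averaging] Prop. 1 (tree: `small_of_plaqSmallOn_blocks`, through W1-18
`TcfgOfRecord_ofBackgroundC_of_plaqBound`) gives the guard, and both transport clauses follow from `hGc`, `hα`, `hsat`. [cite: Balaban1985Averaging, Prop. 1 (51) p.26; Balaban1987RG1, (0.21)-(0.25) pp.256-257, (1.10)-(1.16) p.262] -/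
theorem admTransport_spaceOfRecord_unit_ofRecord_orbit_of_plaqBound (Sg : ℕ → Setting (MatA N) (Node00.SU N)) (α₀ α₁ : ℕ → ℕ → ℝ)
    (hGc : (Sg (k + 1)).𝓜.Gc ≤ (Sg k).𝓜.Gc) {a : ℝ} (ha : 0 ≤ a)
    (haδ : (((((F.P (k + 1)).d + 2) * (F.P (k + 1)).L : ℕ) : ℝ) ^ 2 / 4) * a < deltaSU (Fin N))
    (hplaq : ∀ U : GaugeField (F.P (k + 1)) 0 (Node00.SU N),
      (∀ (j : ℕ) (Y : (domSys (F.P (k + 1)) M j).Dom),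
        ofBackgroundC (ιSU N) U ∈ spaceOfRecord (M := M) (Sg (k + 1)) (Residual.unit (F.P (k + 1)) (MatA N)) (α₀ (k + 1)) (α₁ (k + 1)) j Y) →
        ∀ q : Plaq (F.P (k + 1)) 0, dist1 (GaugeField.plaqHol U q) < a)
    (hα : ∀ j, 0 < α₀ k j)
    (hsat : ∀ (j : ℕ) (Y : (domSys (F.P k) M j).Dom) (Φ : FieldPair (F.P (k + 1)) 0 (MatA N)ˣ (MatA N)),
      SatisfiesI_III (Sg (k + 1)).𝓜 (frameI (Residual.unit (F.P (k + 1)) (MatA N)) M (j + 1) (domSites (F.P (k + 1)) M (j + 1) (pairOfRecord F M k ⟨j, Y⟩).2))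
          (StepConsts.ofParams (F.P (k + 1)) (Sg (k + 1)).cB (j + 1)) (α₀ (k + 1) (j + 1)) (α₁ (k + 1) (j + 1)) (α₀ (k + 1) (j + 1)) Φ →
        ∃ w : Site (F.P k) 0 → (MatA N)ˣ, (∀ x, w x ∈ (Sg k).𝓜.Gc) ∧
          SatisfiesI_III (Sg k).𝓜 (frameI (Residual.unit (F.P k) (MatA N)) M j (domSites (F.P k) M j Y)) (StepConsts.ofParams (F.P k) (Sg k).cB j) (α₀ k j)
            (α₁ k j) (α₀ k j) (act w (TΦOfRecord F N k Φ))) :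
    (∀ (X : Node00.W1.Dom (F.P k) M) (ψ : CPair (F.P (k + 1)) (MatA N)),
        ψ ∈ spaceOfRecord (M := M) (Sg (k + 1)) (Residual.unit (F.P (k + 1)) (MatA N)) (α₀ (k + 1)) (α₁ (k + 1)) (pairOfRecord F M k X).1
            (pairOfRecord F M k X).2 →
          TcfgOfRecord F N k ψ ∈ spaceOfRecord (M := M) (Sg k) (Residual.unit (F.P k) (MatA N)) (α₀ k) (α₁ k) X.1 X.2) ∧
      ∀ U : GaugeField (F.P (k + 1)) 0 (Node00.SU N),
        (∀ (j : ℕ) (Y : (domSys (F.P (k + 1)) M j).Dom),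
            ofBackgroundC (ιSU N) U ∈ spaceOfRecord (M := M) (Sg (k + 1)) (Residual.unit (F.P (k + 1)) (MatA N)) (α₀ (k + 1)) (α₁ (k + 1)) j Y) →
          ∀ (j : ℕ) (Y : (domSys (F.P k) M j).Dom),
            ofBackgroundC (ιSU N) (transportRaw F k (Node00.avOfRecord F N (k + 1) 0) U) ∈
              spaceOfRecord (M := M) (Sg k) (Residual.unit (F.P k) (MatA N)) (α₀ k) (α₁ k) j Y :=
  YMDAG.N18.TransportReduction.admTransport_spaceOfRecord_unit_of_unitsTransport_orbit F N M k (TcfgOfRecord F N k) (TΦOfRecord F N k) Sg α₀ α₁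
    (transportRaw F k (Node00.avOfRecord F N (k + 1) 0)) (fun U hU => TcfgOfRecord_ofBackgroundC_of_plaqBound U ha (hplaq U hU) haδ)
    TcfgOfRecord_embedPair (hcov_TΦOfRecord (Sg (k + 1)) (Sg k) hGc) hα hsat

end Record

end YMDAG.N18.TransportOfRecord

end
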